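import Summits.AnomalousDissipation.AnomalousDissipation.Theorems.SolenoidalFractalHomogenisationLagrangianStepCellLawVQSResp
import HarnessLib

/-!
# K1L `LagrangianRenormalisationStep(Design)` (K1L_D, stmt-AnomalousDissipation-27980; aside 24912), stub `stub_cellLawV0_IS`
# — W2 (iii): the REGULARISED TRANSVERSE BLOCK `B̂(S, n) = P_n Σ(S, n) P_n + n nᵀ` of one slot and the per-slot Loewner pinch of `f_T(B̂) P_n`
# (helper; `--supports stmt-AnomalousDissipation-27980`; word-independent)

Summits-side helper file of route `SolenoidalFractalHomogenisation` (planner ad-ideate-p5's STUB-PLAN for `stub_cellLawV`, `LoewnerWindowSketch` S2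
«QSPinch», tenure WORKER FIT v2 item W2; third of four files, on top of `…CellLawVSemigroupPerp.lean` (p642614) and `…CellLawVQSResp.lean`).
For a background tensor `S : Torus.Visc4 (Fin 3)` and a unit wave vector `n` (`Σ n_a² = 1`): `sigMat S n` (`Σ(S,n)_{ij} = Σ_{ab} S i a j b n_a n_b`),
`projPerp n` (`P_n = 1 − n nᵀ`) and `regBlock S n = P_n Σ P_n + n nᵀ` are the `Sig`, `Pm` and the argument of `qsResp` in the registered-vocabulary
copy `excQS` (next file) — named here so that the slot analysis can be stated.  PROVED: the bilinear form of `Σ(S,n)` is the transverse bilinear symbol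
`Torus.bsymb S n` (`sum_sum_mul_sigMat_mul`); `P_n p = p − (n⬝p)n`, `n ⬝ P_n p = 0`, `|P_n p|² = |p|² − (p⬝n)²`; `n` is a LEFT EIGENVECTOR of `B̂`
(`regBlock_left_eig`), `B̂` is SYMMETRIC when the transverse blocks of `S` are (`regBlock_isSymm`, from `Torus.OddSmall S 0`), and on `n^⊥` its quadratic
form is the transverse symbol `σ_S(n, w)` (`sum_sum_mul_regBlock_mul_of_perp`), hence windowed by `Torus.NearIso S a b` (`regBlock_lower/upper`);
consequently (previous files) the semigroup `e^{−τB̂}` preserves `n^⊥`, the bilinear form of the SLOT RESPONSE `Q = f_T(B̂) P_n` lives on `n^⊥`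
(`sum_sum_mul_qsResp_regBlock_projPerp`), is symmetric (`…_comm`) and is PINCHED:
`f_T(b) |P_n p|² ≤ pᵀ Q p ≤ f_T(a) |P_n p|²` (`le_sum_sum_mul_qsResp_regBlock_projPerp` / `sum_sum_mul_qsResp_regBlock_projPerp_le`, `T ≥ 0`).
No named facts, no sorry.  Infrastructure for route-1's rung leaf F-D1.A0 (frontier FORMAL rung); NOT a proof of the stub, of the crux, of Onsager's
conjecture or of anomalous dissipation.  Prover seat `ad-k1l-cellLawV-w1` g0, 2026-08-28.
-/

set_option linter.dupNamespace false

noncomputable section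

namespace Summit.AnomalousDissipation.AnomalousDissipation.Theorems.SolenoidalFractalHomogenisation.LagrangianStep

open Literature.Analysis Literature.Analysis.FluidPDE Literature.Analysis.FunctionSpaces
open Literature.Analysis.ODE.PeriodicAveraging
open MeasureTheory Set

/-! ## §4 The regularised transverse block `B̂(S, n) = P_n Σ(S, n) P_n + n nᵀ` of one slot -/

section Block

/-- The background symbol matrix at the unit wave vector `n`: `Σ(S, n)_{ij} = Σ_{ab} S i a j b n_a n_b` (the `Sig` of `excShape` / `excQS`). -/
def sigMat (S : Torus.Visc4 (Fin 3)) (n : Fin 3 → ℝ) : Matrix (Fin 3) (Fin 3) ℝ :=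
  fun i' j' => ∑ a', ∑ b', S i' a' j' b' * n a' * n b'

/-- The transverse projector `P_n = 1 − n nᵀ` in coordinates (the `Pm` of `excShape` / `excQS`). -/
def projPerp (n : Fin 3 → ℝ) : Matrix (Fin 3) (Fin 3) ℝ :=
  fun i' j' => (if i' = j' then 1 else 0) - n i' * n j'

/-- The REGULARISED TRANSVERSE BLOCK `B̂(S, n) = P_n Σ(S, n) P_n + n nᵀ` (the argument of `qsResp` in `excQS`; invertible at `S = I`,
where it is the identity). -/
def regBlock (S : Torus.Visc4 (Fin 3)) (n : Fin 3 → ℝ) : Matrix (Fin 3) (Fin 3) ℝ :=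
  projPerp n * sigMat S n * projPerp n + Matrix.vecMulVec n n

variable {S : Torus.Visc4 (Fin 3)} {n : Fin 3 → ℝ}

/-- The bilinear form of `Σ(S, n)` is the transverse bilinear symbol `β_S(n; u, w)`. [folklore] -/
theorem sum_sum_mul_sigMat_mul (S : Torus.Visc4 (Fin 3)) (n u w : Fin 3 → ℝ) :
    ∑ i, ∑ j, u i * sigMat S n i j * w j = Torus.bsymb S n u w := by
  simp only [sigMat, Torus.bsymb, Finset.mul_sum, Finset.sum_mul]
  refine Finset.sum_congr rfl fun i _ => ?_
  rw [Finset.sum_comm]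
  refine Finset.sum_congr rfl fun a _ => Finset.sum_congr rfl fun j _ => Finset.sum_congr rfl fun b _ => ?_
  ring

/-- `P_n p = p − (n ⬝ p) n`. [folklore] -/
theorem projPerp_mulVec (n p : Fin 3 → ℝ) (i : Fin 3) :
    (projPerp n).mulVec p i = p i - n i * ∑ j, n j * p j := by
  simp only [projPerp, Matrix.mulVec, dotProduct, sub_mul, Finset.sum_sub_distrib, ite_mul, one_mul, zero_mul,
    Finset.sum_ite_eq, Finset.mem_univ, if_true, mul_assoc, ← Finset.mul_sum]

/-- `P_n` is symmetric. [folklore] -/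
theorem projPerp_apply_comm (n : Fin 3 → ℝ) (i j : Fin 3) : projPerp n i j = projPerp n j i := by
  simp only [projPerp, eq_comm, mul_comm]

/-- For a unit `n`: `n ⬝ P_n p = 0`. [folklore] -/
theorem sum_mul_projPerp_mulVec (hn : ∑ a, n a ^ 2 = 1) (p : Fin 3 → ℝ) :
    ∑ i, n i * (projPerp n).mulVec p i = 0 := by
  simp only [projPerp_mulVec, mul_sub, Finset.sum_sub_distrib, ← mul_assoc, ← Finset.sum_mul]
  simp only [← sq, hn, one_mul, sub_self]

/-- For a unit `n` and `w ⊥ n`: `P_n w = w`. [folklore] -/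
theorem projPerp_mulVec_of_perp {w : Fin 3 → ℝ} (hw : ∑ i, n i * w i = 0) : (projPerp n).mulVec w = w := by
  funext i
  rw [projPerp_mulVec, hw, mul_zero, sub_zero]

/-- For a unit `n`: `|P_n p|² = |p|² − (p ⬝ n)²`. [folklore] -/
theorem sum_sq_projPerp_mulVec (hn : ∑ a, n a ^ 2 = 1) (p : Fin 3 → ℝ) :
    ∑ i, ((projPerp n).mulVec p i) ^ 2 = ∑ i, p i ^ 2 - (∑ i, p i * n i) ^ 2 := by
  set c := ∑ j, n j * p j with hc
  have hc' : ∑ i, p i * n i = c := by rw [hc]; exact Finset.sum_congr rfl fun i _ => mul_comm _ _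
  simp only [projPerp_mulVec]
  rw [hc']
  have : ∀ i, (p i - n i * c) ^ 2 = p i ^ 2 - 2 * c * (n i * p i) + c ^ 2 * n i ^ 2 := fun i => by ring
  simp only [this, Finset.sum_add_distrib, Finset.sum_sub_distrib, ← Finset.mul_sum, ← hc, hn]
  ring

/-- `n` is a LEFT EIGENVECTOR of the regularised block (eigenvalue `1`), for a unit `n`: `nᵀ B̂ = nᵀ`. [folklore] -/
theorem regBlock_left_eig (hn : ∑ a, n a ^ 2 = 1) (j : Fin 3) : ∑ i, n i * regBlock S n i j = 1 * n j := by
  -- `Σ_i n_i (P Σ P)_{ij} = Σ_l (Σ_{l'} (Σ_i n_i P_{il'}) Σ_{l'l}) P_{lj} = 0` and `Σ_i n_i n_i n_j = n_j`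
  have hP : ∀ l', ∑ i, n i * projPerp n i l' = 0 := by
    intro l'
    have h := sum_mul_projPerp_mulVec hn (Pi.single l' 1)
    simp only [Matrix.mulVec, dotProduct, Pi.single_apply, mul_ite, mul_one, mul_zero, Finset.sum_ite_eq',
      Finset.mem_univ, if_true] at h
    exact h
  simp only [regBlock, Matrix.add_apply, Matrix.mul_apply, Matrix.vecMulVec_apply, mul_add, Finset.sum_add_distrib]
  have h1 : ∑ i, n i * ∑ l, (∑ l', projPerp n i l' * sigMat S n l' l) * projPerp n l j = 0 := by
    calc ∑ i, n i * ∑ l, (∑ l', projPerp n i l' * sigMat S n l' l) * projPerp n l j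
        = ∑ l, ∑ l', (∑ i, n i * projPerp n i l') * (sigMat S n l' l * projPerp n l j) := by
          simp only [Finset.mul_sum, Finset.sum_mul]
          rw [Finset.sum_comm]
          refine Finset.sum_congr rfl fun l _ => ?_
          rw [Finset.sum_comm]
          exact Finset.sum_congr rfl fun l' _ => Finset.sum_congr rfl fun i _ => by ring
      _ = 0 := by simp only [hP, zero_mul, Finset.sum_const_zero]
  have h2 : ∑ i, n i * (n i * n j) = n j := by
    have : ∑ i, n i * (n i * n j) = (∑ i, n i ^ 2) * n j := by
      rw [Finset.sum_mul]; exact Finset.sum_congr rfl fun i _ => by ring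
    rw [this, hn, one_mul]
  rw [h1, h2, zero_add, one_mul]

/-- Entries of `P Σ P` as transverse bilinear symbols of rows/columns of `P`. [folklore] -/
private theorem projSigProj_apply (S : Torus.Visc4 (Fin 3)) (n : Fin 3 → ℝ) (i j : Fin 3) :
    (projPerp n * sigMat S n * projPerp n) i j =
      Torus.bsymb S n (fun l => projPerp n i l) (fun l => projPerp n l j) := by
  rw [← sum_sum_mul_sigMat_mul]
  simp only [Matrix.mul_apply, Finset.sum_mul]
  rw [Finset.sum_comm]

/-- With symmetric transverse blocks (`OddSmall S 0`) and a unit `n`, the regularised block is SYMMETRIC. [folklore] -/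
theorem regBlock_isSymm (hS : Torus.OddSmall S 0) (hn : ∑ a, n a ^ 2 = 1) : (regBlock S n).IsSymm := by
  have hP : ∀ l', ∑ i, n i * projPerp n i l' = 0 := by
    intro l'
    have h := sum_mul_projPerp_mulVec hn (Pi.single l' 1)
    simp only [Matrix.mulVec, dotProduct, Pi.single_apply, mul_ite, mul_one, mul_zero, Finset.sum_ite_eq',
      Finset.mem_univ, if_true] at h
    exact h
  refine Matrix.IsSymm.ext fun i j => ?_
  simp only [regBlock, Matrix.add_apply, Matrix.vecMulVec_apply, projSigProj_apply]
  have hrow : ∀ i, ∑ l, (fun l => projPerp n i l) l * n l = 0 := fun i => by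
    simp only [projPerp_apply_comm n i, mul_comm] ; exact hP i
  have hcol : ∀ j, ∑ l, (fun l => projPerp n l j) l * n l = 0 := fun j => by
    simp only [mul_comm]; exact hP j
  have h := hS n (fun l => projPerp n j l) (fun l => projPerp n l i) (hrow j) (hcol i)
  simp only [zero_pow two_ne_zero, zero_mul] at h
  have h0 : Torus.bsymb S n (fun l => projPerp n j l) (fun l => projPerp n l i)
      = Torus.bsymb S n (fun l => projPerp n l i) (fun l => projPerp n j l) := by
    nlinarith [sq_nonneg (Torus.bsymb S n (fun l => projPerp n j l) (fun l => projPerp n l i)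
      - Torus.bsymb S n (fun l => projPerp n l i) (fun l => projPerp n j l))]
  rw [h0]
  have e1 : (fun l => projPerp n l i) = fun l => projPerp n i l := funext fun l => projPerp_apply_comm n l i
  have e2 : (fun l => projPerp n j l) = fun l => projPerp n l j := funext fun l => projPerp_apply_comm n j l
  rw [e1, e2, mul_comm (n j) (n i)]

/-- On `n^⊥` the quadratic form of the regularised block is the transverse symbol `σ_S(n, w)`. [folklore] -/
theorem sum_sum_mul_regBlock_mul_of_perp {w : Fin 3 → ℝ} (hw : ∑ i, n i * w i = 0) :
    ∑ i, ∑ j, w i * regBlock S n i j * w j = Torus.symb S n w := by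
  have hPw : (projPerp n).mulVec w = w := projPerp_mulVec_of_perp hw
  have hwP : Matrix.vecMul w (projPerp n) = w := by
    have ht : (projPerp n).transpose = projPerp n := by
      ext i j; exact projPerp_apply_comm n j i
    rw [← Matrix.mulVec_transpose, ht, hPw]
  rw [← sum_mul_mulVec_eq_sum_sum, regBlock, Matrix.add_mulVec, ← Matrix.mulVec_mulVec, ← Matrix.mulVec_mulVec, hPw]
  have h1 : ∑ i, w i * ((projPerp n).mulVec ((sigMat S n).mulVec w) + (Matrix.vecMulVec n n).mulVec w) i
      = w ⬝ᵥ (projPerp n).mulVec ((sigMat S n).mulVec w) + w ⬝ᵥ (Matrix.vecMulVec n n).mulVec w := by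
    simp only [Pi.add_apply, mul_add, Finset.sum_add_distrib, dotProduct]
  rw [h1, Matrix.dotProduct_mulVec, hwP]
  have h2 : w ⬝ᵥ (Matrix.vecMulVec n n).mulVec w = 0 := by
    have : ∀ i, (Matrix.vecMulVec n n).mulVec w i = n i * ∑ j, n j * w j := fun i => by
      simp only [Matrix.mulVec, dotProduct, Matrix.vecMulVec_apply, mul_assoc, Finset.mul_sum]
    simp only [dotProduct, this, hw, mul_zero, Finset.sum_const_zero]
  rw [h2, add_zero, Torus.symb_eq_bsymb, ← sum_sum_mul_sigMat_mul, ← sum_mul_mulVec_eq_sum_sum]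
  rfl

/-- Lower window on `n^⊥` (unit `n`, `NearIso S a b`): `a|w|² ≤ wᵀ B̂ w`. [folklore] -/
theorem regBlock_lower (hn : ∑ a, n a ^ 2 = 1) {a b : ℝ} (hS : Torus.NearIso S a b) (w : Fin 3 → ℝ)
    (hw : ∑ i, n i * w i = 0) : a * ∑ i, w i ^ 2 ≤ ∑ i, ∑ j, w i * regBlock S n i j * w j := by
  rw [sum_sum_mul_regBlock_mul_of_perp hw]
  have hw' : ∑ i, w i * n i = 0 := by rw [← hw]; exact Finset.sum_congr rfl fun i _ => mul_comm _ _
  have h := (hS n w hw').1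
  rwa [hn, one_mul] at h

/-- Upper window on `n^⊥` (unit `n`, `NearIso S a b`): `wᵀ B̂ w ≤ b|w|²`. [folklore] -/
theorem regBlock_upper (hn : ∑ a, n a ^ 2 = 1) {a b : ℝ} (hS : Torus.NearIso S a b) (w : Fin 3 → ℝ)
    (hw : ∑ i, n i * w i = 0) : ∑ i, ∑ j, w i * regBlock S n i j * w j ≤ b * ∑ i, w i ^ 2 := by
  rw [sum_sum_mul_regBlock_mul_of_perp hw]
  have hw' : ∑ i, w i * n i = 0 := by rw [← hw]; exact Finset.sum_congr rfl fun i _ => mul_comm _ _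
  have h := (hS n w hw').2
  rwa [hn, one_mul] at h

/-- The semigroup of the regularised block preserves `n^⊥`: `nᵀ e^{−τB̂} P_n q = 0`. [folklore] -/
theorem sum_mul_exp_regBlock_projPerp (hn : ∑ a, n a ^ 2 = 1) (q : Fin 3 → ℝ) (τ : ℝ) :
    ∑ i, n i * (NormedSpace.exp (-(τ • regBlock S n))).mulVec ((projPerp n).mulVec q) i = 0 :=
  sum_mul_exp_neg_smul_mulVec_eq_zero (regBlock S n) (regBlock_left_eig hn) (sum_mul_projPerp_mulVec hn q) τ

/-- **The bilinear form of the slot response `Q = f_T(B̂) P_n` lives on `n^⊥`**: `pᵀ (f_T(B̂) P_n) q = (P_n p)ᵀ f_T(B̂) (P_n q)`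
(unit `n`; the `n`-component of `p` pairs to zero because `e^{−τB̂}` preserves `n^⊥`). [folklore] -/
theorem sum_sum_mul_qsResp_regBlock_projPerp (hn : ∑ a, n a ^ 2 = 1) (ρ T : ℝ) (p q : Fin 3 → ℝ) :
    ∑ i, ∑ j, p i * (qsResp ρ T (regBlock S n) * projPerp n) i j * q j =
      ∑ i, ∑ j, (projPerp n).mulVec p i * qsResp ρ T (regBlock S n) i j * (projPerp n).mulVec q j := by
  rw [← sum_mul_mulVec_eq_sum_sum, ← Matrix.mulVec_mulVec, sum_mul_mulVec_eq_sum_sum]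
  set w := (projPerp n).mulVec q with hw
  set c := ∑ j, n j * p j with hc
  have hp : ∀ i, p i = (projPerp n).mulVec p i + n i * c := fun i => by rw [projPerp_mulVec]; ring
  have hzero : ∑ i, ∑ j, n i * qsResp ρ T (regBlock S n) i j * w j = 0 :=
    sum_sum_mul_qsResp_mul_eq_zero ρ T fun τ => sum_mul_exp_regBlock_projPerp hn q τ
  calc ∑ i, ∑ j, p i * qsResp ρ T (regBlock S n) i j * w j
      = ∑ i, ∑ j, ((projPerp n).mulVec p i * qsResp ρ T (regBlock S n) i j * w j
          + c * (n i * qsResp ρ T (regBlock S n) i j * w j)) := by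
        refine Finset.sum_congr rfl fun i _ => Finset.sum_congr rfl fun j _ => ?_
        rw [hp i]; ring
    _ = ∑ i, ∑ j, (projPerp n).mulVec p i * qsResp ρ T (regBlock S n) i j * w j
          + c * ∑ i, ∑ j, n i * qsResp ρ T (regBlock S n) i j * w j := by
        simp only [Finset.sum_add_distrib, Finset.mul_sum]
    _ = _ := by rw [hzero, mul_zero, add_zero]

/-- The bilinear form of the slot response `Q = f_T(B̂) P_n` is SYMMETRIC (unit `n`, `OddSmall S 0`). [folklore] -/
theorem sum_sum_mul_qsResp_regBlock_projPerp_comm (hS : Torus.OddSmall S 0) (hn : ∑ a, n a ^ 2 = 1) (ρ T : ℝ)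
    (p q : Fin 3 → ℝ) :
    ∑ i, ∑ j, p i * (qsResp ρ T (regBlock S n) * projPerp n) i j * q j =
      ∑ i, ∑ j, q i * (qsResp ρ T (regBlock S n) * projPerp n) i j * p j := by
  rw [sum_sum_mul_qsResp_regBlock_projPerp hn, sum_sum_mul_qsResp_regBlock_projPerp hn,
    sum_sum_mul_qsResp_mul_comm ρ T (regBlock_isSymm hS hn)]

/-- **THE PER-SLOT LOEWNER PINCH, upper half**: `pᵀ (f_T(B̂) P_n) p ≤ f_T(a) |P_n p|²` for a unit `n`, `T ≥ 0`, symmetric transverse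
blocks (`OddSmall S 0`) in the window `NearIso S a b`. [folklore] -/
theorem sum_sum_mul_qsResp_regBlock_projPerp_le (hS : Torus.OddSmall S 0) {a b : ℝ} (hab : Torus.NearIso S a b)
    (hn : ∑ a, n a ^ 2 = 1) {ρ T : ℝ} (hT : 0 ≤ T) (p : Fin 3 → ℝ) :
    ∑ i, ∑ j, p i * (qsResp ρ T (regBlock S n) * projPerp n) i j * p j ≤
      qsRespScalar ρ T a * (∑ i, p i ^ 2 - (∑ i, p i * n i) ^ 2) := by
  rw [sum_sum_mul_qsResp_regBlock_projPerp hn, ← sum_sq_projPerp_mulVec hn]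
  exact sum_sum_mul_qsResp_mul_le hT fun τ hτ =>
    sum_mul_exp_neg_smul_mulVec_le_of_perp (regBlock_isSymm hS hn) (regBlock_left_eig hn)
      (fun w hw => regBlock_lower hn hab w hw) (sum_mul_projPerp_mulVec hn p) hτ

/-- **THE PER-SLOT LOEWNER PINCH, lower half**: `f_T(b) |P_n p|² ≤ pᵀ (f_T(B̂) P_n) p`. [folklore] -/
theorem le_sum_sum_mul_qsResp_regBlock_projPerp (hS : Torus.OddSmall S 0) {a b : ℝ} (hab : Torus.NearIso S a b)
    (hn : ∑ a, n a ^ 2 = 1) {ρ T : ℝ} (hT : 0 ≤ T) (p : Fin 3 → ℝ) :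
    qsRespScalar ρ T b * (∑ i, p i ^ 2 - (∑ i, p i * n i) ^ 2) ≤
      ∑ i, ∑ j, p i * (qsResp ρ T (regBlock S n) * projPerp n) i j * p j := by
  rw [sum_sum_mul_qsResp_regBlock_projPerp hn, ← sum_sq_projPerp_mulVec hn]
  exact le_sum_sum_mul_qsResp_mul hT fun τ hτ =>
    le_sum_mul_exp_neg_smul_mulVec_of_perp (regBlock_isSymm hS hn) (regBlock_left_eig hn)
      (fun w hw => regBlock_upper hn hab w hw) (sum_mul_projPerp_mulVec hn p) hτ

end Block

end Summit.AnomalousDissipation.AnomalousDissipation.Theorems.SolenoidalFractalHomogenisation.LagrangianStep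

end
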